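import Summits.QuantumFields.YangMills.Theorems.IR.Negative.TypShellCondFalseAllG.ZeroTemp

/-!
# Crux `IR` (stmt-QuantumFields-19354) — the fixed-mesh negative for format T and the onset floor FOR EVERY COMPACT
# GAUGE GROUP, part 5/8: §9 the frame value bound for the comb twist (input F); §10a configuration-dependent gauge
# transformations (sections `Frame`, `SkewGauge`)

Re-homed VERBATIM (statements, proofs, names; namespace `…Cruxes.IR.CruxIdea2g6` ↦ `…Cruxes.IR.FixedMeshAllG`) from the crux
workfile `Cruxes/IR/CruxIdea2FrameRowAllG.lean` rev 2 (sha16 81bea4c546c46a61; author `ym-cruxidea-19354-2` GEN 6) per owner R88,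
split by its sections into eight ≤ 400-line modules chained by import; credit docstring of record in the headline module
`Theorems/IR/Negative/TypShellCondFalseAllG.lean` (part 8/8).  Negative knowledge for stmt-QuantumFields-19354; closes no stub.
-/

set_option autoImplicit false

noncomputable section

open MeasureTheory Filter Topology
open Literature.MathematicalPhysics.QuantumLattice
open Literature.Probability.LatticeModels
open Summit.QuantumFields.YangMills.Cruxes.IR.Tempered (cellEdges windowCells regionEdges)
open Summit.QuantumFields.YangMills.Cruxes.IR.ShellTempered (windowCellsPlus)
open Summit.QuantumFields.YangMills.Cruxes.IR.OnsetFormats (TypShellCond shellCount)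
open Summit.QuantumFields.YangMills.Cruxes.IR.FixedMesh

namespace Summit.QuantumFields.YangMills.Cruxes.IR.FixedMeshAllG

/-! ## §9 The frame value bound for the comb twist (PROVED: input F of g5 discharged) -/

section Frame

open Literature.MathematicalPhysics.QuantumFieldTheory (wilsonMeasure GaugeConfig isProbabilityMeasure_wilsonMeasure
  wilsonAction haarProbability plaquetteHolonomy)
open Summit.QuantumFields.YangMills.Theorems.TunedSequenceExists.Negative.Freezing (tendsto_integral_wilsonMeasure
  re_trace_le_of_mem_unitaryGroup continuous_wilsonAction wilsonAction_nonneg integrable_of_continuous)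

variable {G : Type} [Group G] [TopologicalSpace G] [IsTopologicalGroup G] [CompactSpace G]
  [SecondCountableTopology G] [MeasurableSpace G] [BorelSpace G]
  {N : ℕ} (ρ : G →* Matrix (Fin N) (Fin N) ℂ)

/-! ### g5 §4 inputs (copied verbatim from `Cruxes/IR/CruxIdea2FrameRow.lean`) -/

/-- The twist map attached to a frame. -/
def twistΦ (b : ℕ) (κ : LGConfig 4 G → Site 4 → G) (ζ : LGConfig 4 G) : LGConfig 4 G := topTwist b (κ ζ) ζ

/-- **INPUT T (transfer).** -/
def TopTwistTransfer (κ : LGConfig 4 G → Site 4 → G) (b n : ℕ) : Prop :=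
  ∀ (β : ℝ) (Typ : (Fin 4 → ℤ) → Set (LGConfig 4 G)),
    (∀ c, MeasurableSet (Typ c)) →
    (∀ c, DependsOn (fun σ : LGConfig 4 G => σ ∈ Typ c) ↑(cellEdges (stdFrame b) c)) →
    ∀ c ∈ windowCellsPlus n,
      (wilsonMeasure (d := 4) (L := 2 * ((2 * n + 2) * b + 1) + 1) ρ β)
          {V | twistΦ b κ (torusLift (2 * ((2 * n + 2) * b + 1) + 1) V) ∉ Typ c} ≤
        (wilsonMeasure (d := 4) (L := 2 * ((2 * n + 2) * b + 1) + 1) ρ β)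
          {V | torusLift (2 * ((2 * n + 2) * b + 1) + 1) V ∉ Typ c}

/-- The twisted kernel mean of the `σ`-adapted charged test (real part), as a function of the torus sample. -/
def twistedMean (β : ℝ) (b n : ℕ) (κ : LGConfig 4 G → Site 4 → G)
    (V : GaugeConfig 4 (2 * ((2 * n + 2) * b + 1) + 1) G) : ℝ :=
  ∫ U, (chargedTest ρ b ((2 * n + 1) * b) (torusLift (2 * ((2 * n + 2) * b + 1) + 1) V) U).re
    ∂(ymSpecification ρ β (rowRegion b n) (twistΦ b κ (torusLift (2 * ((2 * n + 2) * b + 1) + 1) V)))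

/-- **INPUT F (frame value bound).** -/
def FrameValueBound (κ : LGConfig 4 G → Site 4 → G) (b n : ℕ) (r : ℝ) : Prop :=
  ∀ η : ℝ, 0 < η → ∃ β₀ : ℝ, ∀ β : ℝ, β₀ ≤ β →
    (wilsonMeasure (d := 4) (L := 2 * ((2 * n + 2) * b + 1) + 1) ρ β)
        {V | r + η < twistedMean ρ β b n κ V} ≤ ENNReal.ofReal η

/-! ### rev 2: shaped tests -/

/-- The twisted kernel mean of a SHAPED charged test `ψ ∘ Re` (rev 2), as a function of the torus sample. -/
def twistedMeanObs (β : ℝ) (b n : ℕ) (κ : LGConfig 4 G → Site 4 → G) (ψ : ℝ → ℝ)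
    (V : GaugeConfig 4 (2 * ((2 * n + 2) * b + 1) + 1) G) : ℝ :=
  ∫ U, ψ (chargedTest ρ b ((2 * n + 1) * b) (torusLift (2 * ((2 * n + 2) * b + 1) + 1) V) U).re
    ∂(ymSpecification ρ β (rowRegion b n) (twistΦ b κ (torusLift (2 * ((2 * n + 2) * b + 1) + 1) V)))

/-- **INPUT F for a shaped test** (rev 2): beyond `β₀(η)` the twisted mean of `ψ ∘ Re (charged test)` exceeds `v + η`
only on a set of torus mass `≤ η`.  `FrameValueBoundObs ρ κ b n (fun t => t) r` is `FrameValueBound ρ κ b n r`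
(`Iff.rfl`). -/
def FrameValueBoundObs (κ : LGConfig 4 G → Site 4 → G) (b n : ℕ) (ψ : ℝ → ℝ) (v : ℝ) : Prop :=
  ∀ η : ℝ, 0 < η → ∃ β₀ : ℝ, ∀ β : ℝ, β₀ ≤ β →
    (wilsonMeasure (d := 4) (L := 2 * ((2 * n + 2) * b + 1) + 1) ρ β)
        {V | v + η < twistedMeanObs ρ β b n κ ψ V} ≤ ENNReal.ofReal η

omit [SecondCountableTopology G] in
/-- Workfile theorem `frameValueBoundObs_id_iff` (cruxidea-2 g6, `CruxIdea2FrameRowAllG.lean` rev 2, re-homed verbatim;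
see the module docstring). -/
theorem frameValueBoundObs_id_iff (κ : LGConfig 4 G → Site 4 → G) (b n : ℕ) (r : ℝ) :
    FrameValueBoundObs ρ κ b n (fun t => t) r ↔ FrameValueBound ρ κ b n r := Iff.rfl

/-! ### continuity of the comb twist -/

omit [IsTopologicalGroup G] [CompactSpace G] [SecondCountableTopology G] [MeasurableSpace G] [BorelSpace G] in
/-- Workfile theorem `continuous_zline` (cruxidea-2 g6, `CruxIdea2FrameRowAllG.lean` rev 2, re-homed verbatim;
see the module docstring). -/
theorem continuous_zline [ContinuousMul G] (ν : Fin 4) :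
    ∀ (n : ℕ) (y : Site 4), Continuous fun ζ : LGConfig 4 G => zline ζ ν n y
  | 0, y => by simp only [zline_zero]; exact continuous_const
  | n + 1, y => by simp only [zline_succ]; exact (continuous_apply _).mul (continuous_zline ν n _)

omit [CompactSpace G] [SecondCountableTopology G] [MeasurableSpace G] [BorelSpace G] in
/-- Workfile theorem `continuous_stair` (cruxidea-2 g6, `CruxIdea2FrameRowAllG.lean` rev 2, re-homed verbatim;
see the module docstring). -/
theorem continuous_stair (b R : ℕ) (x : Site 4) : Continuous fun ζ : LGConfig 4 G => stair b R ζ x := by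
  unfold stair
  exact ((continuous_zline 1 _ _).mul (continuous_zline 2 _ _)).mul (continuous_zline 3 _ _)

omit [CompactSpace G] [SecondCountableTopology G] [MeasurableSpace G] [BorelSpace G] in
/-- Workfile theorem `continuous_comb` (cruxidea-2 g6, `CruxIdea2FrameRowAllG.lean` rev 2, re-homed verbatim;
see the module docstring). -/
theorem continuous_comb (b R : ℕ) (k₀ : G) (x : Site 4) : Continuous fun ζ : LGConfig 4 G => comb b R k₀ ζ x := by
  unfold comb
  exact ((continuous_stair b R x).inv.mul continuous_const).mul (continuous_stair b R x)

omit [CompactSpace G] [SecondCountableTopology G] [MeasurableSpace G] [BorelSpace G] in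
/-- Workfile theorem `continuous_twist_comb` (cruxidea-2 g6, `CruxIdea2FrameRowAllG.lean` rev 2, re-homed verbatim;
see the module docstring). -/
theorem continuous_twist_comb (b R : ℕ) (k₀ : G) :
    Continuous fun ζ : LGConfig 4 G => topTwist b (comb b R k₀ ζ) ζ := by
  refine continuous_pi fun e => ?_
  by_cases he : e.2 = 0 ∧ e.1 0 = (b : ℤ)
  · simp only [topTwist, if_pos he]
    exact (continuous_apply e).mul (continuous_comb b R k₀ _).inv
  · simp only [topTwist, if_neg he]
    exact continuous_apply e

/-! ### the bound -/

/-- **F for the comb (PROVED, general torus size, general SHAPED test `ψ ∘ Re`, value `ψ (Re χ_ρ(k₀)/N)`).** -/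
theorem frameValueBound_comb_aux (hρ : Continuous ρ) (hρu : ∀ g, ρ g ∈ Matrix.unitaryGroup (Fin N) ℂ)
    (hρi : Function.Injective ρ) {b : ℕ} (hb : 1 ≤ b) (n : ℕ) (k₀ : G) (L : ℕ) [NeZero L]
    {ψ : ℝ → ℝ} (hψ : Continuous ψ) {η : ℝ} (hη : 0 < η) :
    ∃ β₀ : ℝ, ∀ β : ℝ, β₀ ≤ β →
      (wilsonMeasure (d := 4) (L := L) ρ β)
        {V | ψ ((ρ k₀).trace.re / N) + η <
          ∫ U, ψ (chargedTest ρ b ((2 * n + 1) * b) (torusLift L V) U).re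
            ∂(ymSpecification ρ β (rowRegion b n)
              (topTwist b (comb b ((2 * n + 2) * b + 1) k₀ (torusLift L V)) (torusLift L V)))} ≤ ENNReal.ofReal η := by
  haveI : (haarProbability G).IsOpenPosMeasure := by unfold haarProbability; infer_instance
  have hρN : ∀ g, (ρ g).trace.re ≤ N := fun g => re_trace_le_of_mem_unitaryGroup (hρu g)
  -- the maps
  have htw : Continuous fun V : GaugeConfig 4 L G =>
      topTwist b (comb b ((2 * n + 2) * b + 1) k₀ (torusLift L V)) (torusLift L V) :=
    (continuous_twist_comb b _ k₀).comp (continuous_torusLift L)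
  have hgl : Continuous fun p : GaugeConfig 4 L G × (↥(rowRegion b n) → G) =>
      glueWith (rowRegion b n) p.2 (topTwist b (comb b ((2 * n + 2) * b + 1) k₀ (torusLift L p.1)) (torusLift L p.1)) :=
    (continuous_glueWith_prod (rowRegion b n)).comp ((htw.comp continuous_fst).prodMk continuous_snd)
  have hS : Continuous fun p : GaugeConfig 4 L G × (↥(rowRegion b n) → G) =>
      wilsonBoundaryAction ρ (rowRegion b n) (glueWith (rowRegion b n) p.2
        (topTwist b (comb b ((2 * n + 2) * b + 1) k₀ (torusLift L p.1)) (torusLift L p.1))) :=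
    (continuous_wilsonBoundaryAction ρ hρ _).comp hgl
  have hg0 : Continuous fun p : GaugeConfig 4 L G × (↥(rowRegion b n) → G) =>
      (chargedTest ρ b ((2 * n + 1) * b) (torusLift L p.1) (glueWith (rowRegion b n) p.2
        (topTwist b (comb b ((2 * n + 2) * b + 1) k₀ (torusLift L p.1)) (torusLift L p.1)))).re := by
    unfold chargedTest
    exact Complex.continuous_re.comp (((hρ.comp (((continuous_col b).comp hgl).mul
      ((continuous_staple b _).comp ((continuous_torusLift L).comp continuous_fst)))).matrix_trace).div_const _)
  have hg : Continuous fun p : GaugeConfig 4 L G × (↥(rowRegion b n) → G) =>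
      ψ (chargedTest ρ b ((2 * n + 1) * b) (torusLift L p.1) (glueWith (rowRegion b n) p.2
        (topTwist b (comb b ((2 * n + 2) * b + 1) k₀ (torusLift L p.1)) (torusLift L p.1)))).re := hψ.comp hg0
  have hK : IsClosed {V : GaugeConfig 4 L G | wilsonAction ρ V = 0} :=
    isClosed_eq (continuous_wilsonAction ρ hρ) continuous_const
  -- the zero-temperature value at flat data
  have hmin : ∀ V ∈ {V : GaugeConfig 4 L G | wilsonAction ρ V = 0}, ∀ x : ↥(rowRegion b n) → G,
      (∀ x', (fun p : GaugeConfig 4 L G × (↥(rowRegion b n) → G) =>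
        wilsonBoundaryAction ρ (rowRegion b n) (glueWith (rowRegion b n) p.2
          (topTwist b (comb b ((2 * n + 2) * b + 1) k₀ (torusLift L p.1)) (torusLift L p.1)))) (V, x) ≤
        (fun p : GaugeConfig 4 L G × (↥(rowRegion b n) → G) =>
        wilsonBoundaryAction ρ (rowRegion b n) (glueWith (rowRegion b n) p.2
          (topTwist b (comb b ((2 * n + 2) * b + 1) k₀ (torusLift L p.1)) (torusLift L p.1)))) (V, x')) →
      (fun p : GaugeConfig 4 L G × (↥(rowRegion b n) → G) =>
        ψ (chargedTest ρ b ((2 * n + 1) * b) (torusLift L p.1) (glueWith (rowRegion b n) p.2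
          (topTwist b (comb b ((2 * n + 2) * b + 1) k₀ (torusLift L p.1)) (torusLift L p.1)))).re) (V, x) ≤
        ψ ((ρ k₀).trace.re / N) := by
    intro V hV x hx
    exact (congrArg ψ (chargedTest_re_eq_of_minimiser_comb ρ hρu hρi hb n k₀
      (torusFlat_of_wilsonAction_eq_zero ρ hρu hρi hV) hx)).le
  obtain ⟨O, hO, hKO, β₁, hβ₁⟩ :=
    laplace_upper_uniform (Measure.pi fun _ : ↥(rowRegion b n) => haarProbability G) hS hg hK hmin hη
  -- torus part: `Oᶜ` has positive minimal action, Markov + freezing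
  have hθ : ∃ θ : ℝ, 0 < θ ∧ ∀ V, V ∉ O → θ ≤ wilsonAction ρ V := by
    by_cases hne : (Oᶜ : Set (GaugeConfig 4 L G)).Nonempty
    · obtain ⟨V₁, hV₁, hV₁min⟩ :=
        hO.isClosed_compl.isCompact.exists_isMinOn hne (continuous_wilsonAction ρ hρ).continuousOn
      refine ⟨wilsonAction ρ V₁, lt_of_le_of_ne (wilsonAction_nonneg ρ hρN _) ?_, fun V hV => hV₁min hV⟩
      intro h0
      exact hV₁ (hKO h0.symm)
    · exact ⟨1, one_pos, fun V hV => (hne ⟨V, hV⟩).elim⟩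
  obtain ⟨θ, hθ0, hθle⟩ := hθ
  have hT := tendsto_integral_wilsonMeasure (S := L) ρ hρ hρN (continuous_wilsonAction (S := L) ρ hρ) (c := 0)
    (fun U h => h)
  obtain ⟨β₂, hβ₂⟩ := Filter.eventually_atTop.1 (hT.eventually (gt_mem_nhds (mul_pos hθ0 hη)))
  refine ⟨max β₁ β₂, fun β hβ => ?_⟩
  haveI := isProbabilityMeasure_wilsonMeasure (d := 4) (L := L) ρ hρ β
  -- bad set ⊆ Oᶜ
  have hsub : {V : GaugeConfig 4 L G | ψ ((ρ k₀).trace.re / N) + η <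
      ∫ U, ψ (chargedTest ρ b ((2 * n + 1) * b) (torusLift L V) U).re
        ∂(ymSpecification ρ β (rowRegion b n)
          (topTwist b (comb b ((2 * n + 2) * b + 1) k₀ (torusLift L V)) (torusLift L V)))} ⊆ Oᶜ := by
    intro V hV hVO
    have hL := hβ₁ β (le_trans (le_max_left _ _) hβ) V hVO
    have hF : Measurable fun U : LGConfig 4 G => ψ (chargedTest ρ b ((2 * n + 1) * b) (torusLift L V) U).re :=
      hψ.measurable.comp (Complex.continuous_re.comp (continuous_chargedTest ρ hρ b _ _)).measurable
    have hpos := normaliser_pos ρ hρ β (rowRegion b n)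
      (topTwist b (comb b ((2 * n + 2) * b + 1) k₀ (torusLift L V)) (torusLift L V))
    have hmean : ∫ U, ψ (chargedTest ρ b ((2 * n + 1) * b) (torusLift L V) U).re
        ∂(ymSpecification ρ β (rowRegion b n)
          (topTwist b (comb b ((2 * n + 2) * b + 1) k₀ (torusLift L V)) (torusLift L V))) ≤
        ψ ((ρ k₀).trace.re / N) + η := by
      rw [integral_ymSpecification ρ hρ β (rowRegion b n) hF, div_le_iff₀ hpos]
      exact hL
    exact absurd hV (not_lt.2 hmean)
  -- measure of `Oᶜ`
  have hint : θ * (wilsonMeasure (d := 4) (L := L) ρ β).real {V | θ ≤ wilsonAction ρ V} < θ * η :=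
    lt_of_le_of_lt (mul_meas_ge_le_integral_of_nonneg (ae_of_all _ (wilsonAction_nonneg ρ hρN))
      (integrable_of_continuous _ (continuous_wilsonAction ρ hρ)) θ) (hβ₂ β (le_trans (le_max_right _ _) hβ))
  have hreal : (wilsonMeasure (d := 4) (L := L) ρ β).real Oᶜ ≤ η :=
    le_trans (measureReal_mono (fun V hV => hθle V hV)) (lt_of_mul_lt_mul_left hint hθ0.le).le
  calc (wilsonMeasure (d := 4) (L := L) ρ β) _ ≤ (wilsonMeasure (d := 4) (L := L) ρ β) Oᶜ := measure_mono hsub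
    _ = ENNReal.ofReal ((wilsonMeasure (d := 4) (L := L) ρ β).real Oᶜ) := (ofReal_measureReal (by finiteness)).symm
    _ ≤ ENNReal.ofReal η := ENNReal.ofReal_le_ofReal hreal

/-- **INPUT F DISCHARGED for the comb twist and every shaped test (PROVED, rev 2).** -/
theorem frameValueBoundObs_comb (hρ : Continuous ρ) (hρu : ∀ g, ρ g ∈ Matrix.unitaryGroup (Fin N) ℂ)
    (hρi : Function.Injective ρ) {b : ℕ} (hb : 1 ≤ b) (n : ℕ) (k₀ : G) {ψ : ℝ → ℝ} (hψ : Continuous ψ) :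
    FrameValueBoundObs ρ (comb b ((2 * n + 2) * b + 1) k₀) b n ψ (ψ ((ρ k₀).trace.re / N)) :=
  fun _ hη => frameValueBound_comb_aux ρ hρ hρu hρi hb n k₀ _ hψ hη

/-- **INPUT F DISCHARGED for the comb twist (PROVED).** -/
theorem frameValueBound_comb (hρ : Continuous ρ) (hρu : ∀ g, ρ g ∈ Matrix.unitaryGroup (Fin N) ℂ)
    (hρi : Function.Injective ρ) {b : ℕ} (hb : 1 ≤ b) (n : ℕ) (k₀ : G) :
    FrameValueBound ρ (comb b ((2 * n + 2) * b + 1) k₀) b n ((ρ k₀).trace.re / N) :=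
  fun _ hη => frameValueBound_comb_aux ρ hρ hρu hρi hb n k₀ _ (ψ := fun t => t) continuous_id hη

end Frame

/-! ## §10a Configuration-dependent gauge transformations along a gauge tree (PROVED) -/

section SkewGauge

open Literature.MathematicalPhysics.QuantumFieldTheory (GaugeConfig gaugeTransform haarProbability Edge wilsonMeasure
  wilsonWeight wilsonAction wilsonAction_gaugeTransform)

variable {G : Type} [Group G] [TopologicalSpace G] [IsTopologicalGroup G] [CompactSpace G]
  [SecondCountableTopology G] [MeasurableSpace G] [BorelSpace G]

/-- **Skew-product lemma (PROVED).**  A CONFIGURATION-DEPENDENT gauge transformation `V ↦ V^{h(V)}` preserves the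
product Haar measure provided the gauge function `h(V)` reads only the links of a set `p` of edges which the
transformation itself leaves fixed (a "gauge tree"): in the coordinates `(V|_p, V|_{pᶜ})` it is a skew product over
the identity whose fibre maps are two-sided translations link by link. -/
theorem measurePreserving_gaugeTransform_dep {d L : ℕ} [NeZero L] (p : Edge d L → Prop) [DecidablePred p]
    (h : GaugeConfig d L G → Literature.MathematicalPhysics.QuantumFieldTheory.Site d L → G)
    (hdep : ∀ V W : GaugeConfig d L G, (∀ e, p e → V e = W e) → h V = h W)
    (hfix : ∀ (V : GaugeConfig d L G) (e : Edge d L), p e → gaugeTransform (h V) V e = V e)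
    (hmeas : ∀ x, Measurable fun V => h V x) :
    MeasurePreserving (fun V : GaugeConfig d L G => gaugeTransform (h V) V)
      (Measure.pi fun _ : Edge d L => haarProbability G) (Measure.pi fun _ : Edge d L => haarProbability G) := by
  classical
  let e := MeasurableEquiv.piEquivPiSubtypeProd (fun _ : Edge d L => G) p
  let H : ({x // p x} → G) → Literature.MathematicalPhysics.QuantumFieldTheory.Site d L → G := fun u => h (e.symm (u, fun _ => 1))
  let g : ({x // p x} → G) → ({x // ¬p x} → G) → ({x // ¬p x} → G) :=
    fun u w i => H u i.1.1 * w i * (H u (i.1.1.shift i.1.2))⁻¹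
  have he : MeasurePreserving e (Measure.pi fun _ : Edge d L => haarProbability G)
      ((Measure.pi fun _ : {x // p x} => haarProbability G).prod
        (Measure.pi fun _ : {x // ¬p x} => haarProbability G)) :=
    measurePreserving_piEquivPiSubtypeProd (fun _ : Edge d L => haarProbability G) p
  have hH : ∀ x, Measurable fun u : {x // p x} → G => H u x := fun x =>
    (hmeas x).comp (e.symm.measurable.comp (measurable_id.prodMk measurable_const))
  have hskew : MeasurePreserving
      (fun q : ({x // p x} → G) × ({x // ¬p x} → G) => (id q.1, g q.1 q.2))
      ((Measure.pi fun _ : {x // p x} => haarProbability G).prod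
        (Measure.pi fun _ : {x // ¬p x} => haarProbability G))
      ((Measure.pi fun _ : {x // p x} => haarProbability G).prod
        (Measure.pi fun _ : {x // ¬p x} => haarProbability G)) := by
    refine (MeasurePreserving.id _).skew_product ?_ (ae_of_all _ fun u => ?_)
    · refine measurable_pi_iff.2 fun i => ?_
      exact (((hH _).comp measurable_fst).mul ((measurable_pi_apply i).comp measurable_snd)).mul
        ((hH _).comp measurable_fst).inv
    · exact (measurePreserving_pi (fun _ : {x // ¬p x} => haarProbability G)
        (fun _ : {x // ¬p x} => haarProbability G)
        (f := fun (i : {x // ¬p x}) (y : G) => H u i.1.1 * y * (H u (i.1.1.shift i.1.2))⁻¹)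
        fun i => Literature.MathematicalPhysics.QuantumFieldTheory.WilsonGauge.measurePreserving_mul_mul _ _).map_eq
  have hΨm : Measurable fun V : GaugeConfig d L G => gaugeTransform (h V) V :=
    measurable_pi_iff.2 fun i => ((hmeas _).mul (measurable_pi_apply i)).mul (hmeas _).inv
  refine MeasurePreserving.of_semiconj (he.symm e) hskew (fun q => ?_) hΨm
  -- semiconjugacy: `e.symm (skew q) = Ψ (e.symm q)`
  obtain ⟨u, w⟩ := q
  have hsymm : ∀ (v : ({x // p x} → G) × ({x // ¬p x} → G)) (i : Edge d L),
      (e.symm v : GaugeConfig d L G) i = if hi : p i then v.1 ⟨i, hi⟩ else v.2 ⟨i, hi⟩ := fun v i => rfl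
  have hagree : ∀ i, p i → (e.symm (u, w) : GaugeConfig d L G) i = (e.symm (u, fun _ => 1) : GaugeConfig d L G) i := by
    intro i hi
    rw [hsymm, hsymm, dif_pos hi, dif_pos hi]
  have hh : h (e.symm (u, w)) = H u := hdep _ _ hagree
  funext i
  by_cases hi : p i
  · rw [hfix _ _ hi, hsymm, hsymm, dif_pos hi, dif_pos hi]
    rfl
  · rw [hsymm, dif_neg hi]
    show H u i.1 * w ⟨i, hi⟩ * (H u (i.1.shift i.2))⁻¹ = h (e.symm (u, w)) i.1 * (e.symm (u, w) : GaugeConfig d L G) i *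
      (h (e.symm (u, w)) (i.1.shift i.2))⁻¹
    rw [hh, hsymm, dif_neg hi]

/-- The dependent gauge transformation as a measurable equivalence (inverse: the transformation by `h(V)⁻¹`). -/
def gaugeTreeEquiv {d L : ℕ} [NeZero L] (p : Edge d L → Prop)
    (h : GaugeConfig d L G → Literature.MathematicalPhysics.QuantumFieldTheory.Site d L → G)
    (hdep : ∀ V W : GaugeConfig d L G, (∀ e, p e → V e = W e) → h V = h W)
    (hfix : ∀ (V : GaugeConfig d L G) (e : Edge d L), p e → gaugeTransform (h V) V e = V e)
    (hmeas : ∀ x, Measurable fun V => h V x) : GaugeConfig d L G ≃ᵐ GaugeConfig d L G where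
  toFun V := gaugeTransform (h V) V
  invFun W := gaugeTransform (h W)⁻¹ W
  left_inv V := by
    have hh : h (gaugeTransform (h V) V) = h V := hdep _ _ fun e he => hfix V e he
    funext e
    simp only [hh, gaugeTransform, Pi.inv_apply, inv_inv]
    group
  right_inv W := by
    have hfix' : ∀ e, p e → gaugeTransform (h W)⁻¹ W e = W e := by
      intro e he
      have h1 := hfix W e he
      simp only [gaugeTransform, Pi.inv_apply, inv_inv] at h1 ⊢
      calc (h W e.1)⁻¹ * W e * h W (e.1.shift e.2)
          = (h W e.1)⁻¹ * (h W e.1 * W e * (h W (e.1.shift e.2))⁻¹) * h W (e.1.shift e.2) := by rw [h1]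
        _ = W e := by group
    have hh : h (gaugeTransform (h W)⁻¹ W) = h W := hdep _ _ hfix'
    funext e
    simp only [hh, gaugeTransform, Pi.inv_apply, inv_inv]
    group
  measurable_toFun := measurable_pi_iff.2 fun i => ((hmeas _).mul (measurable_pi_apply i)).mul (hmeas _).inv
  measurable_invFun := measurable_pi_iff.2 fun i => ((hmeas _).inv.mul (measurable_pi_apply i)).mul
    (measurable_inv.comp (measurable_inv.comp (hmeas _)))

/-- **The Wilson measure is invariant under a tree-dependent gauge transformation (PROVED).** -/
theorem wilsonMeasure_map_gaugeTransform_dep {L N : ℕ} [NeZero L] (ρ : G →* Matrix (Fin N) (Fin N) ℂ) (β : ℝ)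
    (p : Edge 4 L → Prop) [DecidablePred p] (h : GaugeConfig 4 L G → Literature.MathematicalPhysics.QuantumFieldTheory.Site 4 L → G)
    (hdep : ∀ V W : GaugeConfig 4 L G, (∀ e, p e → V e = W e) → h V = h W)
    (hfix : ∀ (V : GaugeConfig 4 L G) (e : Edge 4 L), p e → gaugeTransform (h V) V e = V e)
    (hmeas : ∀ x, Measurable fun V => h V x) :
    (wilsonMeasure (d := 4) (L := L) ρ β).map (fun V => gaugeTransform (h V) V) =
      wilsonMeasure (d := 4) (L := L) ρ β := by
  simp only [wilsonMeasure, Measure.map_smul, wilsonWeight]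
  congr 1
  exact Literature.MathematicalPhysics.QuantumFieldTheory.WilsonGauge.withDensity_map_equiv_of_invariant _ (gaugeTreeEquiv p h hdep hfix hmeas) _
    (measurePreserving_gaugeTransform_dep p h hdep hfix hmeas).map_eq fun V => by
      show ENNReal.ofReal (Real.exp (-β * wilsonAction ρ (gaugeTransform (h V) V))) = _
      rw [wilsonAction_gaugeTransform]

end SkewGauge

end Summit.QuantumFields.YangMills.Cruxes.IR.FixedMeshAllG

end
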